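import Mathlib
import Summits.ResolutionOfSingularities.ResolutionOfSingularities.Theorems.AbhyankarShadowsSemivaluationShadowsRankOneSaturation
import HarnessLib

/-!
# Saturation of a rational valuation over a torsion base in the algebraic closure (`stub_baseSaturation`)

Crux `SemivaluationShadows` (item `stmt-ResolutionOfSingularities-16757`, route
`ResolutionOfSingularities/AbhyankarShadows`), line `birth`, registered sub-goal
`stub_baseSaturation`, PROVED: `baseSaturation` (binder form, for an arbitrary algebraic
extension `M/K` carrying a compatible `k`-algebra structure: `baseSaturation_of`) and
`stub_baseSaturation` (the registered one-term signature, by name).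

**Statement.** `k` algebraically closed, `K ⊇ k` a field, `O ∋ k` a valuation ring of `K` which
is RATIONAL (every element of `O` is a constant of `k` modulo `𝔪_O`), and `B ⊆ K` a set over
whose values the values of `K` are torsion (`v(z)^N = v(b)` with `N ≥ 1`, `0 ≠ b ∈ B`, for every
`z ≠ 0`). Then there is a valuation ring `V` of the algebraic closure `M = K̄` with
* (a) `V ∩ K = O` (Chevalley);
* (b) the value of every `z ≠ 0` of `M` is again torsion over the values of `B`;
* (c) `V` is again rational over `k`: every `u` of value `1` is a constant modulo `𝔪_V`;
* (d)–(f) `v` on `K` and `V.valuation ∘ (K → M)` are equivalent valuations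
  (`<1`, `=`, `≤` correspond).

**Proof.** (a) is the tree's `exists_valuationSubring_comap_eq` (Chevalley extension);
(d)–(f) are `isEquiv_valuation_comap` (same valuation ring ⇒ equivalent valuations);
(c) is the residue argument of the rank-one case verbatim
(`exists_polynomial_valuation_aeval_lt_one` and `exists_valuation_sub_algebraMap_lt_one`),
isolated here as `exists_valuation_sub_const_lt_one_of_comap_eq`.
(b): `z` is algebraic over `K`, so `v(z)^N₁ = v(x)` for some `N₁ ≥ 1`, `0 ≠ x ∈ K` (tree
`exists_valuation_pow_eq_of_isAlgebraic`); by hypothesis `v(x)^N₂ = v(b)` downstairs for some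
`N₂ ≥ 1`, `0 ≠ b ∈ B`, i.e. `v(x^N₂) = v(b)`, which transports to `V` by (e); hence
`v(z)^(N₁ N₂) = v(b)`.

## Sources

* S. S. Abhyankar, *Ramification theoretic methods in algebraic geometry*, Annals of
  Mathematics Studies 43, Princeton (1959), §2 (extension of valuations to algebraic extensions:
  value group torsion over the base, residue field algebraic). [folklore]
* O. Zariski, P. Samuel, *Commutative Algebra* II, Ch. VI §§4, 11. [folklore]
-/

-- single-problem summit: the doubled namespace component `ResolutionOfSingularities` is forced
set_option linter.dupNamespace false

noncomputable section

open Literature.AlgebraicGeometry.Resolution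

namespace Summit.ResolutionOfSingularities.ResolutionOfSingularities.Theorems

/-! ## Residues along an algebraic extension of a rational valuation ring are constants -/

/-- **Rationality ascends along algebraic extensions.** `k` algebraically closed, `O ∋ k` a
valuation ring of `K` rational over `k`, `V` a valuation ring of an algebraic extension
`M ⊇ K` with `V ∩ K = O`: every `u ∈ M` of value `1` is a constant of `k` modulo `𝔪_V`.
Indeed some non-zero `g ∈ k[X]` has `v(g(u)) < 1` (`exists_polynomial_valuation_aeval_lt_one`),
and `g` splits into linear factors over `k = k̄`, one of which has value `< 1` at `u`
(`exists_valuation_sub_algebraMap_lt_one`). [folklore] -/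
theorem exists_valuation_sub_const_lt_one_of_comap_eq {k K M : Type} [Field k] [IsAlgClosed k]
    [Field K] [Algebra k K] [Field M] [Algebra K M] [Algebra k M] [IsScalarTower k K M]
    [Algebra.IsAlgebraic K M] (O : ValuationSubring K) (hk : ∀ c : k, algebraMap k K c ∈ O)
    (hrat : ∀ x : K, x ∈ O → ∃ c : k, O.valuation (x - algebraMap k K c) < 1)
    (V : ValuationSubring M) (hV : V.comap (algebraMap K M) = O) (u : M)
    (hu : V.valuation u = 1) :
    ∃ c : k, V.valuation (u - algebraMap K M (algebraMap k K c)) < 1 := by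
  have hkV : ∀ c : k, algebraMap k M c ∈ V := fun c => by
    have h := hk c
    rw [← hV] at h
    rw [IsScalarTower.algebraMap_apply k K M]
    exact ValuationSubring.mem_comap.mp h
  obtain ⟨g, hg0, hlt⟩ := exists_polynomial_valuation_aeval_lt_one O hrat V hV hu.le
    (Algebra.IsAlgebraic.isAlgebraic u)
  obtain ⟨c, hc⟩ := exists_valuation_sub_algebraMap_lt_one V hkV u
    ⟨g, hg0, V.mem_nonunits_iff.mpr hlt⟩
  exact ⟨c, by rwa [IsScalarTower.algebraMap_apply k K M] at hc⟩

/-! ## Values along an algebraic extension stay torsion over the base -/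

/-- **Torsion over a base ascends along algebraic extensions.** `V` a valuation ring of an
algebraic extension `M ⊇ K` with `V ∩ K = O`, and `B ⊆ K` a set over whose values all values
of `K` are torsion (`v(z)^N = v(b)`, `N ≥ 1`, `0 ≠ b ∈ B`); then all values of `M` are torsion
over the values of `B` as well: `v(z)^N₁ = v(x)` with `0 ≠ x ∈ K` by algebraicity
(`exists_valuation_pow_eq_of_isAlgebraic`), `v(x^N₂) = v(b)` downstairs, transported to `V`
(`valuation_map_eq_iff`), whence `v(z)^(N₁N₂) = v(b)`. [folklore] -/
theorem exists_valuation_pow_eq_base_of_comap_eq {K M : Type} [Field K] [Field M] [Algebra K M]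
    [Algebra.IsAlgebraic K M] (O : ValuationSubring K) (V : ValuationSubring M)
    (hV : V.comap (algebraMap K M) = O) (B : Set K)
    (hB : ∀ z : K, z ≠ 0 → ∃ N : ℕ, N ≠ 0 ∧ ∃ b ∈ B, b ≠ 0 ∧ O.valuation z ^ N = O.valuation b)
    (z : M) (hz : z ≠ 0) :
    ∃ N : ℕ, N ≠ 0 ∧ ∃ b ∈ B, b ≠ 0 ∧ V.valuation z ^ N = V.valuation (algebraMap K M b) := by
  have halgK : IsAlgebraic K z := Algebra.IsAlgebraic.isAlgebraic z
  have halg : IsAlgebraic (algebraMap K M).fieldRange z :=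
    halgK.ringHom_of_comp_eq (B := M) (algebraMap K M).rangeRestrictField (RingHom.id M)
      (RingHom.rangeRestrictField_bijective _).1 (RingHom.ext fun _ => rfl)
  obtain ⟨n, hn, b, hb, hzb⟩ := exists_valuation_pow_eq_of_isAlgebraic V halg hz
  obtain ⟨x, rfl⟩ := RingHom.mem_fieldRange.mp hb
  have hx0 : x ≠ 0 := by
    rintro rfl
    rw [map_zero, map_zero, map_pow, pow_eq_zero_iff hn, map_eq_zero] at hzb
    exact hz hzb
  obtain ⟨N, hN, b, hbB, hb0, hxb⟩ := hB x hx0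
  -- transport `v(x)^N = v(b)` to `V`
  have hxb' : V.valuation (algebraMap K M x) ^ N = V.valuation (algebraMap K M b) := by
    have h : O.valuation (x ^ N) = O.valuation b := by rw [map_pow, hxb]
    rw [← valuation_map_eq_iff (algebraMap K M) hV] at h
    rwa [map_pow, map_pow] at h
  refine ⟨n * N, mul_ne_zero hn hN, b, hbB, hb0, ?_⟩
  rw [pow_mul, ← map_pow, hzb, hxb']

/-! ## The saturation theorem over a torsion base -/

/-- **Saturation along an algebraic extension, over a torsion base** (general form of
`baseSaturation`): for `k` algebraically closed, `O ∋ k` a rational valuation ring of `K`,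
`B ⊆ K` a set over whose values the values of `K` are torsion, and ANY algebraic extension
`M/K` (with its `k`-algebra structure through `K`), there is a valuation ring `V` of `M` with
`V ∩ K = O` whose values are torsion over the values of `B`, which is again rational over `k`,
and whose valuation restricts to one equivalent to `v_O`. [folklore] -/
theorem baseSaturation_of {k K M : Type} [Field k] [IsAlgClosed k] [Field K] [Algebra k K]
    [Field M] [Algebra K M] [Algebra k M] [IsScalarTower k K M] [Algebra.IsAlgebraic K M]
    (O : ValuationSubring K) (hk : ∀ c : k, algebraMap k K c ∈ O)
    (hrat : ∀ x : K, x ∈ O → ∃ c : k, O.valuation (x - algebraMap k K c) < 1) (B : Set K)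
    (hB : ∀ z : K, z ≠ 0 → ∃ N : ℕ, N ≠ 0 ∧ ∃ b ∈ B, b ≠ 0 ∧ O.valuation z ^ N = O.valuation b) :
    ∃ V : ValuationSubring M, V.comap (algebraMap K M) = O ∧
      (∀ z : M, z ≠ 0 → ∃ N : ℕ, N ≠ 0 ∧ ∃ b ∈ B, b ≠ 0 ∧
        V.valuation z ^ N = V.valuation (algebraMap K M b)) ∧
      (∀ u : M, V.valuation u = 1 →
        ∃ c : k, V.valuation (u - algebraMap K M (algebraMap k K c)) < 1) ∧
      (∀ x : K, O.valuation x < 1 ↔ V.valuation (algebraMap K M x) < 1) ∧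
      (∀ x x' : K, O.valuation x = O.valuation x' ↔
        V.valuation (algebraMap K M x) = V.valuation (algebraMap K M x')) ∧
      (∀ x x' : K, O.valuation x ≤ O.valuation x' ↔
        V.valuation (algebraMap K M x) ≤ V.valuation (algebraMap K M x')) := by
  -- (a) Chevalley
  obtain ⟨V, hV⟩ := exists_valuationSubring_comap_eq (Ω := M) O
  have he := isEquiv_valuation_comap (algebraMap K M) hV
  refine ⟨V, hV, ?_, ?_, ?_, ?_, ?_⟩
  · -- (b) values are torsion over the values of `B`
    intro z hz
    exact exists_valuation_pow_eq_base_of_comap_eq O V hV B hB z hz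
  · -- (c) residues are constants
    intro u hu
    exact exists_valuation_sub_const_lt_one_of_comap_eq O hk hrat V hV u hu
  · -- (d)
    intro x
    exact (valuation_map_lt_one_iff (algebraMap K M) hV x).symm
  · -- (e)
    intro x x'
    exact (valuation_map_eq_iff (algebraMap K M) hV x x').symm
  · -- (f)
    intro x x'
    exact (he x x').symm

/-- **Saturation over a torsion base in the algebraic closure** (binder form of the registered
sub-goal `stub_baseSaturation`): `k` algebraically closed, `O ∋ k` a rational valuation ring of
`K`, `B ⊆ K` a set over whose values the values of `K` are torsion; then some valuation ring
`V` of `M = K̄` has (a) `V ∩ K = O`, (b) all values torsion over the values of `B`, (c) all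
residues constants of `k`, and (d)–(f) `v_O` and `v_V ∘ (K → M)` compare `< 1`, `=`, `≤`
identically. [folklore] -/
theorem baseSaturation (k K : Type) [Field k] [IsAlgClosed k] [Field K] [Algebra k K]
    (O : ValuationSubring K) (hk : ∀ c : k, algebraMap k K c ∈ O)
    (hrat : ∀ x : K, x ∈ O → ∃ c : k, O.valuation (x - algebraMap k K c) < 1) (B : Set K)
    (hB : ∀ z : K, z ≠ 0 → ∃ N : ℕ, N ≠ 0 ∧ ∃ b ∈ B, b ≠ 0 ∧ O.valuation z ^ N = O.valuation b) :
    ∃ V : ValuationSubring (AlgebraicClosure K),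
      V.comap (algebraMap K (AlgebraicClosure K)) = O ∧
      (∀ z : AlgebraicClosure K, z ≠ 0 → ∃ N : ℕ, N ≠ 0 ∧ ∃ b ∈ B, b ≠ 0 ∧
        V.valuation z ^ N = V.valuation (algebraMap K (AlgebraicClosure K) b)) ∧
      (∀ u : AlgebraicClosure K, V.valuation u = 1 →
        ∃ c : k, V.valuation (u - algebraMap K (AlgebraicClosure K) (algebraMap k K c)) < 1) ∧
      (∀ x : K, O.valuation x < 1 ↔ V.valuation (algebraMap K (AlgebraicClosure K) x) < 1) ∧
      (∀ x x' : K, O.valuation x = O.valuation x' ↔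
        V.valuation (algebraMap K (AlgebraicClosure K) x) =
          V.valuation (algebraMap K (AlgebraicClosure K) x')) ∧
      (∀ x x' : K, O.valuation x ≤ O.valuation x' ↔
        V.valuation (algebraMap K (AlgebraicClosure K) x) ≤
          V.valuation (algebraMap K (AlgebraicClosure K) x')) :=
  baseSaturation_of (M := AlgebraicClosure K) O hk hrat B hB

/-! ## The registered sub-goal, by name -/

/-- **SUB-GOAL `stub_baseSaturation` of line `birth` of crux `SemivaluationShadows`, PROVED**
(the registered one-term signature, by name): saturation of a rational valuation ring
`O ∋ k = k̄` of `K` in the algebraic closure `K̄` over a torsion base `B ⊆ K` — an extension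
`V` with `V ∩ K = O`, values torsion over the values of `B`, residues constants, and `v_O`,
`v_V` comparing identically on `K` — `baseSaturation`. [folklore] -/
theorem stub_baseSaturation : ∀ (k K : Type) [Field k] [IsAlgClosed k] [Field K] [Algebra k K] (O : ValuationSubring K), (∀ c : k, algebraMap k K c ∈ O) → (∀ x : K, x ∈ O → ∃ c : k, O.valuation (x - algebraMap k K c) < 1) → ∀ (B : Set K), (∀ z : K, z ≠ 0 → ∃ N : ℕ, N ≠ 0 ∧ ∃ b ∈ B, b ≠ 0 ∧ O.valuation z ^ N = O.valuation b) → ∃ V : ValuationSubring (AlgebraicClosure K), V.comap (algebraMap K (AlgebraicClosure K)) = O ∧ (∀ z : AlgebraicClosure K, z ≠ 0 → ∃ N : ℕ, N ≠ 0 ∧ ∃ b ∈ B, b ≠ 0 ∧ V.valuation z ^ N = V.valuation (algebraMap K (AlgebraicClosure K) b)) ∧ (∀ u : AlgebraicClosure K, V.valuation u = 1 → ∃ c : k, V.valuation (u - algebraMap K (AlgebraicClosure K) (algebraMap k K c)) < 1) ∧ (∀ x : K, O.valuation x < 1 ↔ V.valuation (algebraMap K (AlgebraicClosure K) x) < 1)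 ∧ (∀ x x' : K, O.valuation x = O.valuation x' ↔ V.valuation (algebraMap K (AlgebraicClosure K) x) = V.valuation (algebraMap K (AlgebraicClosure K) x')) ∧ (∀ x x' : K, O.valuation x ≤ O.valuation x' ↔ V.valuation (algebraMap K (AlgebraicClosure K) x) ≤ V.valuation (algebraMap K (AlgebraicClosure K) x')) := by
  intro k K _ _ _ _ O hk hrat B hB
  exact baseSaturation k K O hk hrat B hB

end Summit.ResolutionOfSingularities.ResolutionOfSingularities.Theorems

end
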